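import Mathlib
import Literature.NumberTheory.LFunctions.Zhang2022.Section16Eval1617Rel
import Literature.NumberTheory.LFunctions.Zhang2022.Section3Lemma31
import Literature.NumberTheory.LFunctions.Zhang2022.Section17Lemma171
import Literature.NumberTheory.Sieve.BombieriAsymptoticSieveShiftedPrimes
import HarnessLib

/-!
# Zhang (2022), §16 p. 95 in the RELATIVE reading with the TWO-PIECE (16.16):
# `(16.12) + (16.16)ᴿ² + u044 ⇒ Φ₂(p) = −(𝔢₁+𝔢₂)𝔞p + o((𝔞+1)p)` and `(16.2) + that ⇒ (16.17)ᴿ`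
# — the RT-03 precondition `eval1617Rel_of_R2`

Topic `Literature/NumberTheory/LFunctions/Zhang2022` (Landau–Siegel audit tree; verdict-neutral).
Y. Zhang, *Discrete mean estimates and the Landau–Siegel zero*, arXiv:2211.02515v1 (2022)
[Zhang2022LandauSiegel] — **an unrefereed manuscript under adjudication**; the displays referred to are
CLAIM nodes (`Typed.Section16A`, `Typed.Section16B`, `SkeletonPartThree`), stated not asserted.
ZHANG-L discharge lane (WP16, seat zl-w16-p4), zl-lead rulings R-15/R-17 (RT-03), planner sketch S1.

The tree's relative §16 endgame `Skeleton.eval1617Rel_of_leaves` (`Section16Eval1617Rel`) consumes the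
PRINTED (16.16) (`Typed.Section16B.Eq16_16 c′`, uniform error `C𝓛⁻⁴`), which the printed route does not
transmit (rows G-L4t5-1/G-L4t5-2/G-d57-1). What the repaired §16B chain DOES transmit
(`Typed.Section16B.eq16_16R2_of_subleaves`, file `Section16Eq1616R2`) is (16.16) with the two-piece error

> `‖𝒮₂ⱼ − 𝔞𝔢ⱼ(φ(D)/D)L′(1,χ)‖ ≤ C·(𝓛⁻¹ + (1+|L′(1,χ)|)³𝓛⁻⁴)`

(node `Typed.Section16B.Eq16_16R2`, filed by zl-w16-typer; here SPELLED INLINE verbatim — no new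
`def … : Prop` by a prover, R1). This file proves that the two-piece (16.16) still yields (16.17) in the
relative reading `Skeleton.Eval1617Rel c′` (`‖Φ₂ − (𝔢₁+𝔢₂)𝔞𝔓‖ ≤ ε(𝔞+1)𝔓`) — the ONLY form the §2
composition consumes (`SkeletonEvalRel.eval181Rel_of_parts`) — using tree facts only:

* the cross term of `Skeleton.endgame_core`, `(Dp/φ(D))·‖v_j‖/‖L′‖` with `v_j = 𝒮₂ⱼ − 𝔞𝔢ⱼ(φ/D)L′`:
  piece `C𝓛⁻¹` is absorbed by Lemma 5.7 (`Skeleton.self_div_totient_le_norm_deriv_L_one`: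
  `D/φ(D) ≤ 4e|L′(1,χ)|` under (A)); piece `C(1+|L′|)³𝓛⁻⁴` by the budget `ε𝔞p`, through
  `(1+x)³ ≤ 4(1+x³)`, `|L′|² ≤ (π²/6)(1+𝓛)𝔞` (`norm_deriv_sq_le_mul_frakA`: `𝔞 = (6/π²)L′(1,χ)²∏_{q∣D}q/(q+1)`
  with `L′(1,χ)` real, `Lemma171.deriv_LFunction_one_im`, and `∏_{q∣D}(1+1/q) ≤ 1 + log D`,
  `Literature.NumberTheory.Sieve.prod_primeFactors_one_add_inv_le` + `sum_divisors_inv_le`) and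
  `|L′(1,χ)| ≤ 2e^{9/2}(1+𝓛)𝓛` (`Lemma31.norm_deriv_LFunction_le_near_one`), which give
  `(D/φ)‖v_j‖/‖L′‖ ≤ 20eC𝓛⁻¹ + (64π²/3)e^{11/2}C·𝔞𝓛⁻¹` (`cross_piece_le`);
* `endgame_term2` / `endgame_core2` — the algebra of `Skeleton.endgame_term` / `endgame_core` with the
  cross term carried as an abstract bound `X`;
* `phi2p_evalRel_of_parts2` — `‖Φ₂(p) + (𝔢₁+𝔢₂)𝔞p‖ ≤ ε(𝔞+1)p` uniformly for `p ∼ P`, all large `D`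
  under (A), from (16.12), the two-piece (16.16) and u044 — NO size input on `𝔞`;
* `step16_u045Rel_of_R2` and **`eval1617Rel_of_R2 : Prop141 → Step16_u010 c′ → Eq16_12 c′ →
  (two-piece (16.16)) → Eval1617Rel c′`** (the RT-03 precondition; u044 is the tree theorem
  `ResidueValues.step16_u044_holds`, (16.2) ⇐ Prop 14.1 + u010 is `Skeleton.eq16_2_of_prop141`, and the
  passage (16.2) + relative u045 ⇒ (16.17)ᴿ is the tree's `Skeleton.eval1617Rel_of_parts`, unchanged).

Theorems only; no definitions, no named facts; axioms standard. WHAT THIS IS NOT: a proof of (16.12),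
u010, Prop. 14.1 or of the sub-leaves under (16.16); any claim about Theorems 1–2 of the source or about
Landau–Siegel zeros; nothing here bears on the refuted §18 margin.

## References

* Y. Zhang, arXiv:2211.02515v1 (2022), §16 (16.2), (16.12), (16.16), (16.17), p. 95, tex L4670–L4687;
  §5 Lemma 5.7; §2 (2.13), (2.31); §3 Lemma 3.1. [cite: Zhang2022LandauSiegel, §16 (16.17) p.95]
-/

noncomputable section

open Complex Real

namespace Literature.NumberTheory.LFunctions.Zhang2022.Skeleton

/-! ## Sizes: `|L′(1,χ)|² ≤ (π²/6)(1+𝓛)𝔞` -/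

section Sizes

/-- `∏_{q∣D} q/(q+1) ≥ (1 + log D)⁻¹` (`D ≠ 0`): the product is the inverse of `∏_{q∣D}(1 + 1/q) ≤
Σ_{m∣D} 1/m ≤ 1 + log D` (tree: `Literature.NumberTheory.Sieve.prod_primeFactors_one_add_inv_le`,
`sum_divisors_inv_le`). [cite: Zhang2022LandauSiegel, §2 (2.31)] -/
theorem inv_one_add_log_le_prod_primeFactors {D : ℕ} (hD : D ≠ 0) :
    (1 + Real.log D)⁻¹ ≤ ∏ p ∈ D.primeFactors, ((p : ℝ) / (p + 1)) := by
  have hprod : ∏ p ∈ D.primeFactors, ((p : ℝ) / (p + 1)) =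
      (∏ p ∈ D.primeFactors, (1 + (p : ℝ)⁻¹))⁻¹ := by
    rw [← Finset.prod_inv_distrib]
    refine Finset.prod_congr rfl fun p hp => ?_
    have hp0 : (p : ℝ) ≠ 0 := by exact_mod_cast (Nat.prime_of_mem_primeFactors hp).ne_zero
    field_simp
  have hpos : 0 < ∏ p ∈ D.primeFactors, (1 + (p : ℝ)⁻¹) :=
    Finset.prod_pos fun p _ => by positivity
  rw [hprod]
  exact inv_anti₀ hpos ((Literature.NumberTheory.Sieve.prod_primeFactors_one_add_inv_le hD).trans
    (Literature.NumberTheory.Sieve.sum_divisors_inv_le D))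

/-- **`|L′(1,χ)|² ≤ (π²/6)(1 + log D)·𝔞`** for a quadratic `χ ≠ 1`: `𝔞 = (6/π²)L′(1,χ)²∏_{q∣D}q/(q+1)`
(2.31) with `L′(1,χ)` real (`Lemma171.deriv_LFunction_one_im`) and `∏_{q∣D}q/(q+1) ≥ (1+log D)⁻¹`.
[cite: Zhang2022LandauSiegel, §2 (2.31)] -/
theorem norm_deriv_sq_le_mul_frakA {D : ℕ} [NeZero D] (χ : DirichletCharacter ℂ D) (hχ1 : χ ≠ 1)
    (hq : χ ^ 2 = 1) :
    ‖deriv χ.LFunction 1‖ ^ 2 ≤ π ^ 2 / 6 * (1 + Real.log D) * frakA χ := by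
  have him := Lemma171.deriv_LFunction_one_im χ hχ1 hq
  have hre : (deriv χ.LFunction 1).re ^ 2 = ‖deriv χ.LFunction 1‖ ^ 2 := by
    rw [Complex.sq_norm, Complex.normSq_apply, him]; ring
  have hlog0 : 0 ≤ Real.log D := Real.log_natCast_nonneg D
  have hP := inv_one_add_log_le_prod_primeFactors (NeZero.ne D)
  have hx0 : 0 ≤ ‖deriv χ.LFunction 1‖ ^ 2 := sq_nonneg _
  rw [frakA, Lemma171.frakA_def, hre]
  have hπ0 : 0 < π ^ 2 / 6 := by positivity
  -- `x² = (π²/6)(1+log D) · [(6/π²) x² (1+log D)⁻¹] ≤ (π²/6)(1+log D) · [(6/π²) x² ∏]`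
  calc ‖deriv χ.LFunction 1‖ ^ 2
      = π ^ 2 / 6 * (1 + Real.log D) *
          (6 / π ^ 2 * ‖deriv χ.LFunction 1‖ ^ 2 * (1 + Real.log D)⁻¹) := by
        field_simp
    _ ≤ π ^ 2 / 6 * (1 + Real.log D) *
          (6 / π ^ 2 * ‖deriv χ.LFunction 1‖ ^ 2 * ∏ p ∈ D.primeFactors, ((p : ℝ) / (p + 1))) := by
        gcongr

/-- `(1 + x)³ ≤ 4(1 + x³)` for `x ≥ 0` (convexity of the cube). [folklore] -/
private theorem one_add_pow_three_le {x : ℝ} (hx : 0 ≤ x) : (1 + x) ^ 3 ≤ 4 + 4 * x ^ 3 := by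
  nlinarith [sq_nonneg (x - 1), sq_nonneg x, mul_nonneg hx (sq_nonneg (x - 1))]

end Sizes

/-! ## The endgame with the cross term carried abstractly -/

section Endgame

/-- One term of the endgame with an abstract cross bound: for `u = 𝓡*𝓡ⱼ + 1/L`, `v = 𝒮ⱼ − 𝔞𝔢ⱼ(φ/D)L`,
`|u| ≤ C₂ℓ⁻¹|L|⁻¹` and `(D/φ)·|v|·|L|⁻¹ ≤ X`: `(D/φ)·|u𝒮ⱼ − v/L| ≤ (1 + C₂)X + C₂|𝔢ⱼ|·𝔞·ℓ⁻¹` (`ℓ ≥ 1`).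
[cite: Zhang2022LandauSiegel, §16 p.95] -/
theorem endgame_term2 {u S v L e : ℂ} {a φ Dr C₂ X ℓ : ℝ} (hL : L ≠ 0) (hφ : 0 < φ) (hD : 0 < Dr)
    (ha : 0 ≤ a) (hC₂ : 0 ≤ C₂) (hℓ : 1 ≤ ℓ)
    (hv : v = S - a * e * (φ / Dr) * L) (hX : Dr / φ * ‖v‖ * ‖L‖⁻¹ ≤ X)
    (h44 : ‖u‖ ≤ C₂ * ℓ⁻¹ * ‖L‖⁻¹) :
    Dr / φ * ‖u * S - v / L‖ ≤ (1 + C₂) * X + C₂ * ‖e‖ * a * ℓ⁻¹ := by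
  have hℓ0 : 0 < ℓ := by linarith
  set nL : ℝ := ‖L‖ with hnL
  have hnL0 : 0 < nL := norm_pos_iff.mpr hL
  have hρ0 : 0 ≤ Dr / φ := by positivity
  have hX0 : 0 ≤ X := le_trans (by positivity) hX
  -- `‖S‖ ≤ ‖v‖ + a‖e‖(φ/D)‖L‖`
  have hS : ‖S‖ ≤ ‖v‖ + a * ‖e‖ * (φ / Dr) * nL := by
    have : S = v + a * e * (φ / Dr) * L := by rw [hv]; ring
    rw [this]
    refine (norm_add_le _ _).trans ?_
    have hn : ‖(a * e * (φ / Dr) * L : ℂ)‖ = a * ‖e‖ * (φ / Dr) * nL := by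
      rw [norm_mul, norm_mul, norm_mul, Complex.norm_real, Real.norm_of_nonneg ha, ← ofReal_div,
        Complex.norm_real, Real.norm_of_nonneg (by positivity)]
    rw [hn]
  -- `‖uS − v/L‖ ≤ ‖u‖‖S‖ + ‖v‖/‖L‖`
  have h1 : ‖u * S - v / L‖ ≤
      C₂ * ℓ⁻¹ * nL⁻¹ * (‖v‖ + a * ‖e‖ * (φ / Dr) * nL) + ‖v‖ * nL⁻¹ := by
    calc ‖u * S - v / L‖ ≤ ‖u‖ * ‖S‖ + ‖v‖ * nL⁻¹ := by
          refine (norm_sub_le _ _).trans ?_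
          rw [norm_mul, norm_div, hnL, div_eq_mul_inv]
      _ ≤ _ := by gcongr
  have hρφ : Dr / φ * (φ / Dr) = 1 := by field_simp
  have hℓinv1 : ℓ⁻¹ ≤ 1 := inv_le_one_of_one_le₀ hℓ
  have hXv : Dr / φ * ‖v‖ * nL⁻¹ ≤ X := hX
  calc Dr / φ * ‖u * S - v / L‖
      ≤ Dr / φ * (C₂ * ℓ⁻¹ * nL⁻¹ * (‖v‖ + a * ‖e‖ * (φ / Dr) * nL) + ‖v‖ * nL⁻¹) :=
        mul_le_mul_of_nonneg_left h1 hρ0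
    _ = C₂ * ℓ⁻¹ * (Dr / φ * ‖v‖ * nL⁻¹) +
          C₂ * ‖e‖ * a * ℓ⁻¹ * (Dr / φ * (φ / Dr)) * (nL * nL⁻¹) + Dr / φ * ‖v‖ * nL⁻¹ := by ring
    _ = C₂ * ℓ⁻¹ * (Dr / φ * ‖v‖ * nL⁻¹) + C₂ * ‖e‖ * a * ℓ⁻¹ + Dr / φ * ‖v‖ * nL⁻¹ := by
        rw [hρφ, mul_inv_cancel₀ hnL0.ne']; ring
    _ ≤ C₂ * 1 * X + C₂ * ‖e‖ * a * ℓ⁻¹ + X := by gcongr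
    _ = (1 + C₂) * X + C₂ * ‖e‖ * a * ℓ⁻¹ := by ring

/-- **The cross term under the two-piece (16.16)**: with `ρ = D/φ(D) ≤ 4e|L′|` (Lemma 5.7),
`|L′|² ≤ (π²/6)(1+ℓ)𝔞`, `|L′| ≤ 2e^{9/2}(1+ℓ)ℓ` (Lemma 3.1-type bound), `ℓ ≥ 1`, and
`|v| ≤ C(ℓ⁻¹ + (1+|L′|)³ℓ⁻⁴)`: `ρ·|v|·|L′|⁻¹ ≤ 20eC·ℓ⁻¹ + (64π²/3)e·e^{9/2}·C·𝔞·ℓ⁻¹`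
(`(1+x)³ ≤ 4 + 4x³`, `ρx² ≤ 8e^{11/2}(1+ℓ)ℓ·(π²/6)(1+ℓ)𝔞`, `(1+ℓ)²/ℓ³ ≤ 4/ℓ`).
[cite: Zhang2022LandauSiegel, §16 (16.16)–(16.17) p.95] -/
theorem cross_piece_le {v L : ℂ} {a ρ C ℓ : ℝ} (hL : L ≠ 0) (hC : 0 ≤ C) (hℓ : 1 ≤ ℓ) (ha : 0 ≤ a)
    (hρ0 : 0 ≤ ρ) (hρL : ρ ≤ 4 * Real.exp 1 * ‖L‖)
    (hLa : ‖L‖ ^ 2 ≤ π ^ 2 / 6 * (1 + ℓ) * a)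
    (hLu : ‖L‖ ≤ 2 * Real.exp (9 / 2) * (1 + ℓ) * ℓ)
    (hv : ‖v‖ ≤ C * (ℓ⁻¹ + (1 + ‖L‖) ^ 3 * (ℓ ^ 4)⁻¹)) :
    ρ * ‖v‖ * ‖L‖⁻¹ ≤
      20 * Real.exp 1 * C * ℓ⁻¹ + 64 * π ^ 2 / 3 * Real.exp 1 * Real.exp (9 / 2) * C * a * ℓ⁻¹ := by
  have hℓ0 : 0 < ℓ := by linarith
  set nL : ℝ := ‖L‖ with hnL
  have hnL0 : 0 < nL := norm_pos_iff.mpr hL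
  have he1 : 0 < Real.exp 1 := Real.exp_pos 1
  have he9 : 0 < Real.exp (9 / 2) := Real.exp_pos _
  have hinv0 : 0 < ℓ⁻¹ := inv_pos.mpr hℓ0
  have hinv4 : 0 ≤ (ℓ ^ 4)⁻¹ := by positivity
  -- (1) `ρ/|L| ≤ 4e`
  have hρnL : ρ * nL⁻¹ ≤ 4 * Real.exp 1 := by
    rw [← div_eq_mul_inv, div_le_iff₀ hnL0]; exact hρL
  -- (2) `ρ |L|² ≤ 8e e^{9/2}(1+ℓ)ℓ · (π²/6)(1+ℓ)a`
  have hρx2 : ρ * nL ^ 2 ≤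
      (8 * Real.exp 1 * Real.exp (9 / 2) * (1 + ℓ) * ℓ) * (π ^ 2 / 6 * (1 + ℓ) * a) := by
    have h1 : ρ * nL ^ 2 ≤ ρ * (π ^ 2 / 6 * (1 + ℓ) * a) := mul_le_mul_of_nonneg_left hLa hρ0
    have h2 : ρ ≤ 8 * Real.exp 1 * Real.exp (9 / 2) * (1 + ℓ) * ℓ := by
      calc ρ ≤ 4 * Real.exp 1 * nL := hρL
        _ ≤ 4 * Real.exp 1 * (2 * Real.exp (9 / 2) * (1 + ℓ) * ℓ) :=
            mul_le_mul_of_nonneg_left hLu (by positivity)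
        _ = 8 * Real.exp 1 * Real.exp (9 / 2) * (1 + ℓ) * ℓ := by ring
    exact h1.trans (mul_le_mul_of_nonneg_right h2 (by positivity))
  -- (3) `|v| ≤ Cℓ⁻¹ + C(4 + 4|L|³)ℓ⁻⁴`
  have hcube := one_add_pow_three_le (norm_nonneg L)
  have hv' : ‖v‖ ≤ C * ℓ⁻¹ + 4 * C * (ℓ ^ 4)⁻¹ + 4 * C * nL ^ 3 * (ℓ ^ 4)⁻¹ := by
    calc ‖v‖ ≤ C * (ℓ⁻¹ + (1 + nL) ^ 3 * (ℓ ^ 4)⁻¹) := hv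
      _ ≤ C * (ℓ⁻¹ + (4 + 4 * nL ^ 3) * (ℓ ^ 4)⁻¹) := by gcongr
      _ = C * ℓ⁻¹ + 4 * C * (ℓ ^ 4)⁻¹ + 4 * C * nL ^ 3 * (ℓ ^ 4)⁻¹ := by ring
  -- expand `ρ |v| / |L|`
  have hρv : ρ * ‖v‖ * nL⁻¹ ≤
      C * (ρ * nL⁻¹) * ℓ⁻¹ + 4 * C * (ρ * nL⁻¹) * (ℓ ^ 4)⁻¹ +
        4 * C * (ρ * nL ^ 2) * (ℓ ^ 4)⁻¹ := by
    have : ρ * ‖v‖ * nL⁻¹ = (ρ * nL⁻¹) * ‖v‖ := by ring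
    rw [this]
    calc (ρ * nL⁻¹) * ‖v‖
        ≤ (ρ * nL⁻¹) * (C * ℓ⁻¹ + 4 * C * (ℓ ^ 4)⁻¹ + 4 * C * nL ^ 3 * (ℓ ^ 4)⁻¹) :=
          mul_le_mul_of_nonneg_left hv' (by positivity)
      _ = C * (ρ * nL⁻¹) * ℓ⁻¹ + 4 * C * (ρ * nL⁻¹) * (ℓ ^ 4)⁻¹ +
          4 * C * (ρ * (nL⁻¹ * nL ^ 3)) * (ℓ ^ 4)⁻¹ := by ring
      _ = _ := by
          rw [show nL⁻¹ * nL ^ 3 = nL ^ 2 by field_simp]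
  -- sizes of the powers of `ℓ`
  have hℓ4 : (ℓ ^ 4)⁻¹ ≤ ℓ⁻¹ := by
    rw [inv_le_inv₀ (pow_pos hℓ0 4) hℓ0]; exact le_self_pow₀ hℓ (by norm_num)
  have hℓ3 : (1 + ℓ) * ℓ * (1 + ℓ) * (ℓ ^ 4)⁻¹ ≤ 4 * ℓ⁻¹ := by
    have hnum : (1 + ℓ) * ℓ * (1 + ℓ) ≤ 4 * ℓ ^ 3 := by nlinarith [pow_pos hℓ0 2]
    have h3 : (ℓ ^ 3 : ℝ) ≠ 0 := (pow_pos hℓ0 3).ne'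
    calc (1 + ℓ) * ℓ * (1 + ℓ) * (ℓ ^ 4)⁻¹ ≤ 4 * ℓ ^ 3 * (ℓ ^ 4)⁻¹ :=
          mul_le_mul_of_nonneg_right hnum hinv4
      _ = 4 * ℓ⁻¹ := by
          rw [show (ℓ ^ 4 : ℝ) = ℓ ^ 3 * ℓ by ring, mul_inv, ← mul_assoc, mul_assoc 4,
            mul_inv_cancel₀ h3, mul_one]
  calc ρ * ‖v‖ * nL⁻¹
      ≤ C * (ρ * nL⁻¹) * ℓ⁻¹ + 4 * C * (ρ * nL⁻¹) * (ℓ ^ 4)⁻¹ +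
          4 * C * (ρ * nL ^ 2) * (ℓ ^ 4)⁻¹ := hρv
    _ ≤ C * (4 * Real.exp 1) * ℓ⁻¹ + 4 * C * (4 * Real.exp 1) * ℓ⁻¹ +
          4 * C * ((8 * Real.exp 1 * Real.exp (9 / 2) * (1 + ℓ) * ℓ) * (π ^ 2 / 6 * (1 + ℓ) * a)) *
            (ℓ ^ 4)⁻¹ := by
        gcongr
    _ = 20 * Real.exp 1 * C * ℓ⁻¹ +
          16 * π ^ 2 / 3 * Real.exp 1 * Real.exp (9 / 2) * C * a *
            ((1 + ℓ) * ℓ * (1 + ℓ) * (ℓ ^ 4)⁻¹) := by ring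
    _ ≤ 20 * Real.exp 1 * C * ℓ⁻¹ +
          16 * π ^ 2 / 3 * Real.exp 1 * Real.exp (9 / 2) * C * a * (4 * ℓ⁻¹) := by
        gcongr
    _ = 20 * Real.exp 1 * C * ℓ⁻¹ + 64 * π ^ 2 / 3 * Real.exp 1 * Real.exp (9 / 2) * C * a * ℓ⁻¹ := by
        ring

/-- **The endgame of §16 with the two-piece (16.16)** (all quantities explicit): from
(16.12) `|Φ − 𝓡*(Dp/φ)(𝓡₁𝒮₁ + 𝓡₂𝒮₂)| ≤ ε₁p`, (16.16)ᴿ² `|𝒮ⱼ − 𝔞𝔢ⱼ(φ/D)L| ≤ C₁(ℓ⁻¹ + (1+|L|)³ℓ⁻⁴)`,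
`|𝓡*𝓡ⱼ + 1/L| ≤ C₂ℓ⁻¹|L|⁻¹`, `D/φ ≤ 4e|L|` (Lemma 5.7), `|L|² ≤ (π²/6)(1+ℓ)𝔞`, `|L| ≤ 2e^{9/2}(1+ℓ)ℓ`:
`|Φ + (𝔢₁+𝔢₂)𝔞p| ≤ (ε₁ + A·ℓ⁻¹ + B·𝔞·ℓ⁻¹)p` with `A = 2(1+C₂)·20eC₁`,
`B = 2(1+C₂)·(64π²/3)e^{11/2}C₁ + C₂(|𝔢₁|+|𝔢₂|)` — via the exact identity of `Skeleton.endgame_core`,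
`Φ + (𝔢₁+𝔢₂)𝔞p = (Φ − 𝓡*(Dp/φ)Σ𝓡ⱼ𝒮ⱼ) + (Dp/φ)Σⱼ(uⱼ𝒮ⱼ − vⱼ/L)`. [cite: Zhang2022LandauSiegel, §16 p.95] -/
theorem endgame_core2 {Φ Rs R₁ R₂ S₁ S₂ L e₁ e₂ : ℂ} {Dn φn p : ℕ} {a ε₁ C₁ C₂ ℓ : ℝ}
    (hL : L ≠ 0) (hφ : 0 < φn) (hD : 0 < Dn) (ha : 0 ≤ a) (hC₁ : 0 ≤ C₁) (hC₂ : 0 ≤ C₂)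
    (hℓ : 1 ≤ ℓ)
    (hρL : (Dn : ℝ) / φn ≤ 4 * Real.exp 1 * ‖L‖)
    (hLa : ‖L‖ ^ 2 ≤ π ^ 2 / 6 * (1 + ℓ) * a)
    (hLu : ‖L‖ ≤ 2 * Real.exp (9 / 2) * (1 + ℓ) * ℓ)
    (h12 : ‖Φ - Rs * ((Dn : ℝ) * p : ℝ) / (φn : ℂ) * (R₁ * S₁ + R₂ * S₂)‖ ≤ ε₁ * p)
    (h16₁ : ‖S₁ - (a : ℂ) * e₁ * ((φn : ℂ) / (Dn : ℂ)) * L‖ ≤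
      C₁ * (ℓ⁻¹ + (1 + ‖L‖) ^ 3 * (ℓ ^ 4)⁻¹))
    (h16₂ : ‖S₂ - (a : ℂ) * e₂ * ((φn : ℂ) / (Dn : ℂ)) * L‖ ≤
      C₁ * (ℓ⁻¹ + (1 + ‖L‖) ^ 3 * (ℓ ^ 4)⁻¹))
    (h44₁ : ‖Rs * R₁ + 1 / L‖ ≤ C₂ * ℓ⁻¹ * ‖L‖⁻¹)
    (h44₂ : ‖Rs * R₂ + 1 / L‖ ≤ C₂ * ℓ⁻¹ * ‖L‖⁻¹) :
    ‖Φ + (e₁ + e₂) * a * p‖ ≤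
      (ε₁ + 2 * (1 + C₂) * (20 * Real.exp 1 * C₁) * ℓ⁻¹ +
        (2 * (1 + C₂) * (64 * π ^ 2 / 3 * Real.exp 1 * Real.exp (9 / 2) * C₁) +
          C₂ * (‖e₁‖ + ‖e₂‖)) * a * ℓ⁻¹) * p := by
  have hφ0 : (φn : ℂ) ≠ 0 := Nat.cast_ne_zero.mpr hφ.ne'
  have hD0 : (Dn : ℂ) ≠ 0 := Nat.cast_ne_zero.mpr hD.ne'
  set u₁ : ℂ := Rs * R₁ + 1 / L
  set u₂ : ℂ := Rs * R₂ + 1 / L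
  set v₁ : ℂ := S₁ - (a : ℂ) * e₁ * ((φn : ℂ) / (Dn : ℂ)) * L with hv₁
  set v₂ : ℂ := S₂ - (a : ℂ) * e₂ * ((φn : ℂ) / (Dn : ℂ)) * L with hv₂
  -- the exact identity (as in `endgame_core`)
  have hX : (((Dn : ℝ) * p : ℝ) : ℂ) = (Dn : ℂ) * (p : ℂ) := by push_cast; ring
  have hid : Φ + (e₁ + e₂) * a * p =
      (Φ - Rs * ((Dn : ℝ) * p : ℝ) / (φn : ℂ) * (R₁ * S₁ + R₂ * S₂)) +
      ((Dn : ℂ) * p / φn) * ((u₁ * S₁ - v₁ / L) + (u₂ * S₂ - v₂ / L)) := by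
    rw [hX]
    simp only [u₁, u₂, hv₁, hv₂]
    field_simp
    ring
  rw [hid]
  have hρ : ‖((Dn : ℂ) * p / φn : ℂ)‖ = (Dn : ℝ) / φn * p := by
    rw [norm_div, norm_mul, Complex.norm_natCast, Complex.norm_natCast, Complex.norm_natCast]; ring
  have hρ0 : 0 ≤ (Dn : ℝ) / φn := by positivity
  -- the cross bounds
  set X : ℝ := 20 * Real.exp 1 * C₁ * ℓ⁻¹ +
    64 * π ^ 2 / 3 * Real.exp 1 * Real.exp (9 / 2) * C₁ * a * ℓ⁻¹ with hXdef
  have hXv₁ : (Dn : ℝ) / φn * ‖v₁‖ * ‖L‖⁻¹ ≤ X :=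
    cross_piece_le hL hC₁ hℓ ha hρ0 hρL hLa hLu h16₁
  have hXv₂ : (Dn : ℝ) / φn * ‖v₂‖ * ‖L‖⁻¹ ≤ X :=
    cross_piece_le hL hC₁ hℓ ha hρ0 hρL hLa hLu h16₂
  -- casts `((φ:ℕ):ℂ) = (((φ:ℕ):ℝ):ℂ)` for `endgame_term2`
  have t₁ := endgame_term2 (e := e₁) (S := S₁) (u := u₁) hL (Nat.cast_pos.mpr hφ)
    (Nat.cast_pos.mpr hD) ha hC₂ hℓ (by simp only [hv₁, Complex.ofReal_natCast]) hXv₁ h44₁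
  have t₂ := endgame_term2 (e := e₂) (S := S₂) (u := u₂) hL (Nat.cast_pos.mpr hφ)
    (Nat.cast_pos.mpr hD) ha hC₂ hℓ (by simp only [hv₂, Complex.ofReal_natCast]) hXv₂ h44₂
  have hp0 : (0 : ℝ) ≤ p := Nat.cast_nonneg p
  calc ‖(Φ - Rs * ((Dn : ℝ) * p : ℝ) / (φn : ℂ) * (R₁ * S₁ + R₂ * S₂)) +
        ((Dn : ℂ) * p / φn) * ((u₁ * S₁ - v₁ / L) + (u₂ * S₂ - v₂ / L))‖
      ≤ ‖Φ - Rs * ((Dn : ℝ) * p : ℝ) / (φn : ℂ) * (R₁ * S₁ + R₂ * S₂)‖ +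
        ‖((Dn : ℂ) * p / φn : ℂ)‖ * (‖u₁ * S₁ - v₁ / L‖ + ‖u₂ * S₂ - v₂ / L‖) := by
          refine (norm_add_le _ _).trans ?_
          rw [norm_mul]
          gcongr
          exact norm_add_le _ _
    _ = ‖Φ - Rs * ((Dn : ℝ) * p : ℝ) / (φn : ℂ) * (R₁ * S₁ + R₂ * S₂)‖ +
        p * ((Dn : ℝ) / φn * ‖u₁ * S₁ - v₁ / L‖ + (Dn : ℝ) / φn * ‖u₂ * S₂ - v₂ / L‖) := by
          rw [hρ]; ring
    _ ≤ ε₁ * p + p * (((1 + C₂) * X + C₂ * ‖e₁‖ * a * ℓ⁻¹) +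
        ((1 + C₂) * X + C₂ * ‖e₂‖ * a * ℓ⁻¹)) :=
          add_le_add h12 (mul_le_mul_of_nonneg_left (add_le_add t₁ t₂) hp0)
    _ = (ε₁ + 2 * (1 + C₂) * (20 * Real.exp 1 * C₁) * ℓ⁻¹ +
        (2 * (1 + C₂) * (64 * π ^ 2 / 3 * Real.exp 1 * Real.exp (9 / 2) * C₁) +
          C₂ * (‖e₁‖ + ‖e₂‖)) * a * ℓ⁻¹) * p := by rw [hXdef]; ring

/-- **§16 p. 95, "This together with (16.16) and (16.12) yields `Φ₂(p) = −(𝔢₁+𝔢₂)𝔞p + o(p)`" in the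
RELATIVE reading, from the TWO-PIECE (16.16)** (DAG `Z22:§16.u045` ⇐ `Z22:(16.12)` + `Z22:(16.16)`ᴿ² +
`Z22:§16.u044`): for ANY `Φ₂(p)`, `𝓡₂*`, `𝓡₂ⱼ`, `𝒮₂ⱼ`, from (16.12), `‖𝒮₂ⱼ − 𝔞𝔢ⱼ(φ/D)L′‖ ≤
C(𝓛⁻¹ + (1+|L′|)³𝓛⁻⁴)`, the `𝓡₂*𝓡₂ⱼ` display u044 and the tree's Lemma 5.7 / (2.31) / Lemma 3.1 sizes:
`‖Φ₂(p) + (𝔢₁+𝔢₂)𝔞p‖ ≤ ε(𝔞+1)p` uniformly for `p ∼ P`, for all large `D` under (A) — NO size input on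
`𝔞` (`endgame_core2`; the residual `(ε/3 + A𝓛⁻¹ + B𝔞𝓛⁻¹)p` is `≤ ε(𝔞+1)p` once `𝓛 ≥ 3(A+B)/ε`).
[cite: Zhang2022LandauSiegel, §16 p.95] -/
theorem phi2p_evalRel_of_parts2
    (Φ : (D : ℕ) → [NeZero D] → DirichletCharacter ℂ D → ℕ → ℂ)
    (Rs : (D : ℕ) → [NeZero D] → DirichletCharacter ℂ D → ℂ)
    (R S : (D : ℕ) → [NeZero D] → DirichletCharacter ℂ D → ℕ → ℂ)
    (h1612 : ∀ ε : ℝ, 0 < ε → ForAllLarge fun D _ χ => AssumptionA D χ → ∀ p ∈ primeWindow D,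
      ‖Φ D χ p - Rs D χ * ((D : ℝ) * p : ℝ) / (Nat.totient D : ℂ) *
        ∑ j ∈ ({1, 2} : Finset ℕ), R D χ j * S D χ j‖ ≤ ε * p)
    (h1616 : ∃ C : ℝ, ForAllLarge fun D _ χ => AssumptionA D χ → ∀ j ∈ ({1, 2} : Finset ℕ),
      ‖S D χ j - (frakA χ : ℂ) * frake j * ((Nat.totient D : ℂ) / (D : ℂ)) * deriv χ.LFunction 1‖ ≤
        C * ((ell D)⁻¹ + (1 + ‖deriv χ.LFunction 1‖) ^ 3 * (ell D ^ 4)⁻¹))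
    (h44 : ∃ C : ℝ, ForAllLarge fun D _ χ => AssumptionA D χ → ∀ j ∈ ({1, 2} : Finset ℕ),
      ‖Rs D χ * R D χ j + 1 / deriv χ.LFunction 1‖ ≤ C * (ell D)⁻¹ * ‖deriv χ.LFunction 1‖⁻¹) :
    ∀ ε : ℝ, 0 < ε → ForAllLarge fun D _ χ => AssumptionA D χ → ∀ p ∈ primeWindow D,
      ‖Φ D χ p + (frake 1 + frake 2) * frakA χ * p‖ ≤ ε * (frakA χ + 1) * p := by
  intro ε hε
  obtain ⟨C₁, hC₁⟩ := h1616
  obtain ⟨C₂, hC₂⟩ := h44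
  set C₁' : ℝ := max C₁ 0 with hC₁'
  set C₂' : ℝ := max C₂ 0 with hC₂'
  have hC₁'0 : 0 ≤ C₁' := le_max_right _ _
  have hC₂'0 : 0 ≤ C₂' := le_max_right _ _
  set E : ℝ := ‖frake 1‖ + ‖frake 2‖ with hE
  have hE0 : 0 ≤ E := by positivity
  have hε3 : 0 < ε / 3 := by positivity
  set A : ℝ := 2 * (1 + C₂') * (20 * Real.exp 1 * C₁') with hA
  set B : ℝ := 2 * (1 + C₂') * (64 * π ^ 2 / 3 * Real.exp 1 * Real.exp (9 / 2) * C₁') + C₂' * E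
    with hB
  have hA0 : 0 ≤ A := by positivity
  have hB0 : 0 ≤ B := by positivity
  obtain ⟨Dl, hDl⟩ := self_div_totient_le_norm_deriv_L_one
  obtain ⟨D₁, h₁⟩ := ((h1612 _ hε3).and hC₁).and hC₂
  obtain ⟨D₂, h₂⟩ := exists_forall_le_ell (max 3 (3 * (A + B) / ε))
  refine ⟨max (max D₁ D₂) Dl, fun D _ χ hD hq hp hA' p hpW => ?_⟩
  have hD1 : D₁ ≤ D := le_trans (le_trans (le_max_left _ _) (le_max_left _ _)) hD
  have hD2 : D₂ ≤ D := le_trans (le_trans (le_max_right _ _) (le_max_left _ _)) hD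
  have hDl' : Dl ≤ D := le_trans (le_max_right _ _) hD
  obtain ⟨⟨e12, e16⟩, e44⟩ := h₁ D χ hD1 hq hp
  have hM := h₂ D hD2
  have hℓ3 : 3 ≤ ell D := le_trans (le_max_left _ _) hM
  have hℓK : 3 * (A + B) / ε ≤ ell D := le_trans (le_max_right _ _) hM
  have hℓ1 : 1 ≤ ell D := by linarith
  have hℓ0 : 0 < ell D := by linarith
  have hLge := hDl D χ hDl' hq hp hA'
  -- `L′(1,χ) ≠ 0`
  have hρpos : 0 < (D : ℝ) / Nat.totient D := by
    have := NeZero.pos D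
    have hφ := Nat.totient_pos.mpr this
    positivity
  have hL0 : deriv χ.LFunction 1 ≠ 0 := by
    intro h
    rw [h, norm_zero, mul_zero] at hLge
    linarith
  -- `χ ≠ 1` (`D ≥ 2` as `log D ≥ 3`), so `L′(1,χ)` is real and the (2.31)/Lemma 3.1 sizes apply
  have hD2 : 2 ≤ D := by
    by_contra hlt
    have hD1' : D ≤ 1 := by omega
    have : Real.log (D : ℝ) ≤ 0 := by
      rcases Nat.le_one_iff_eq_zero_or_eq_one.mp hD1' with h0 | h1
      · simp [h0]
      · simp [h1]
    have hℓdef : ell D = Real.log D := rfl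
    linarith
  have hχ1 : χ ≠ 1 := Lemma31.ne_one_of_isPrimitive χ hD2 hp
  have hLa : ‖deriv χ.LFunction 1‖ ^ 2 ≤ π ^ 2 / 6 * (1 + ell D) * frakA χ :=
    norm_deriv_sq_le_mul_frakA χ hχ1 hq.sq_eq_one
  have hLu : ‖deriv χ.LFunction 1‖ ≤ 2 * Real.exp (9 / 2) * (1 + ell D) * ell D := by
    have h := Lemma31.norm_deriv_LFunction_le_near_one χ (q := D) hℓ3 hp (w := 1)
      (by rw [sub_self, norm_zero]; positivity)
    exact h
  have h1mem : (1 : ℕ) ∈ ({1, 2} : Finset ℕ) := by simp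
  have h2mem : (2 : ℕ) ∈ ({1, 2} : Finset ℕ) := by simp
  -- the inputs at this `D, χ, p`
  have g12 := e12 hA' p hpW
  rw [Finset.sum_pair (by norm_num : (1 : ℕ) ≠ 2)] at g12
  have hW0 : 0 ≤ (ell D)⁻¹ + (1 + ‖deriv χ.LFunction 1‖) ^ 3 * (ell D ^ 4)⁻¹ := by positivity
  have g16₁ : ‖S D χ 1 - (frakA χ : ℂ) * frake 1 * ((Nat.totient D : ℂ) / (D : ℂ)) *
      deriv χ.LFunction 1‖ ≤ C₁' * ((ell D)⁻¹ + (1 + ‖deriv χ.LFunction 1‖) ^ 3 * (ell D ^ 4)⁻¹) :=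
    (e16 hA' 1 h1mem).trans (mul_le_mul_of_nonneg_right (le_max_left _ _) hW0)
  have g16₂ : ‖S D χ 2 - (frakA χ : ℂ) * frake 2 * ((Nat.totient D : ℂ) / (D : ℂ)) *
      deriv χ.LFunction 1‖ ≤ C₁' * ((ell D)⁻¹ + (1 + ‖deriv χ.LFunction 1‖) ^ 3 * (ell D ^ 4)⁻¹) :=
    (e16 hA' 2 h2mem).trans (mul_le_mul_of_nonneg_right (le_max_left _ _) hW0)
  have hy : 0 ≤ (ell D)⁻¹ * ‖deriv χ.LFunction 1‖⁻¹ := by positivity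
  have g44₁ : ‖Rs D χ * R D χ 1 + 1 / deriv χ.LFunction 1‖ ≤
      C₂' * (ell D)⁻¹ * ‖deriv χ.LFunction 1‖⁻¹ := by
    refine (e44 hA' 1 h1mem).trans ?_
    rw [mul_assoc, mul_assoc]
    exact mul_le_mul_of_nonneg_right (le_max_left _ _) hy
  have g44₂ : ‖Rs D χ * R D χ 2 + 1 / deriv χ.LFunction 1‖ ≤
      C₂' * (ell D)⁻¹ * ‖deriv χ.LFunction 1‖⁻¹ := by
    refine (e44 hA' 2 h2mem).trans ?_
    rw [mul_assoc, mul_assoc]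
    exact mul_le_mul_of_nonneg_right (le_max_left _ _) hy
  have hA0' : 0 ≤ frakA χ := frakA_nonneg χ
  have key := endgame_core2 (Φ := Φ D χ p) (Rs := Rs D χ) (e₁ := frake 1) (e₂ := frake 2) hL0
    (Nat.totient_pos.mpr (NeZero.pos D)) (NeZero.pos D) hA0' hC₁'0 hC₂'0 hℓ1 hLge hLa hLu
    g12 g16₁ g16₂ g44₁ g44₂
  refine key.trans ?_
  have hp0 : (0 : ℝ) ≤ p := Nat.cast_nonneg p
  refine mul_le_mul_of_nonneg_right ?_ hp0
  -- `ε/3 + A𝓛⁻¹ + B𝔞𝓛⁻¹ ≤ ε(𝔞+1)` from `3(A+B)/ε ≤ 𝓛`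
  have hℓK' : 3 * (A + B) ≤ ell D * ε := by rwa [div_le_iff₀ hε] at hℓK
  have hAℓ : A * (ell D)⁻¹ ≤ ε / 3 := by
    rw [← div_eq_mul_inv, div_le_iff₀ hℓ0]; linarith
  have hBℓ : B * (ell D)⁻¹ ≤ ε / 3 := by
    rw [← div_eq_mul_inv, div_le_iff₀ hℓ0]; linarith
  have hBaℓ : B * frakA χ * (ell D)⁻¹ ≤ ε / 3 * frakA χ := by
    have := mul_le_mul_of_nonneg_right hBℓ hA0'
    calc B * frakA χ * (ell D)⁻¹ = B * (ell D)⁻¹ * frakA χ := by ring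
      _ ≤ ε / 3 * frakA χ := this
  have hfold : ε / 3 + 2 * (1 + C₂') * (20 * Real.exp 1 * C₁') * (ell D)⁻¹ +
      (2 * (1 + C₂') * (64 * π ^ 2 / 3 * Real.exp 1 * Real.exp (9 / 2) * C₁') +
        C₂' * (‖frake 1‖ + ‖frake 2‖)) * frakA χ * (ell D)⁻¹ =
      ε / 3 + A * (ell D)⁻¹ + B * frakA χ * (ell D)⁻¹ := by rw [hA, hB, hE]
  rw [hfold]
  have hεA : 0 ≤ ε * frakA χ := mul_nonneg hε.le hA0'
  linarith

/-! ## On the typed nodes: the RT-03 precondition -/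

/-- **u045 in the relative reading from (16.12) and the TWO-PIECE (16.16)** (the `𝓡₂*𝓡₂ⱼ` display u044
being the tree theorem `ResidueValues.step16_u044_holds`), NO size input on `𝔞`: for all large `D` under
(A), `‖Φ₂(p) + (𝔢₁+𝔢₂)𝔞p‖ ≤ ε(𝔞+1)p` for `p ∼ P`. The second hypothesis is the node
`Typed.Section16B.Eq16_16R2 c′` spelled inline. [cite: Zhang2022LandauSiegel, §16 p.95] -/
theorem step16_u045Rel_of_R2 (c' : ℝ) (h1612 : Typed.Section16A.Eq16_12 c')
    (h16R2 : ∃ C : ℝ, ForAllLarge fun D _ χ => AssumptionA D χ → ∀ j ∈ ({1, 2} : Finset ℕ),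
      ‖Typed.Section16A.calS2 c' χ j -
          (frakA χ : ℂ) * frake j * ((Nat.totient D : ℂ) / (D : ℂ)) * deriv χ.LFunction 1‖ ≤
        C * ((ell D)⁻¹ + (1 + ‖deriv χ.LFunction 1‖) ^ 3 * (ell D ^ 4)⁻¹)) :
    ∀ ε : ℝ, 0 < ε → ForAllLarge fun D _ χ => AssumptionA D χ → ∀ p ∈ primeWindow D,
      ‖Typed.Section16A.Phi2p c' χ p + (frake 1 + frake 2) * frakA χ * p‖ ≤ ε * (frakA χ + 1) * p :=
  phi2p_evalRel_of_parts2 (fun _ _ χ p => Typed.Section16A.Phi2p c' χ p)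
    (fun _ _ χ => Typed.Section16A.calR2star c' χ) (fun _ _ χ j => Typed.Section16A.calR2 c' χ j)
    (fun _ _ χ j => Typed.Section16A.calS2 c' χ j) h1612 h16R2 (ResidueValues.step16_u044_holds c')

/-- **RT-03 precondition** (zl-lead R-17; planner sketch S1 `eval1617Rel_of_R2`, signature verbatim with
the node `Typed.Section16B.Eq16_16R2 c′` spelled inline): Proposition 14.1 + u010 + (16.12) + the
TWO-PIECE (16.16) ⇒ (16.17)ᴿ = `Skeleton.Eval1617Rel c′` — (16.2) ⇐ Prop. 14.1 + u010 is
`Skeleton.eq16_2_of_prop141`, u043/u044 are tree theorems, the in-line `(pt₀)^{β₁} = −1 + O(α₁)` claim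
and the passage to (16.17)ᴿ are the tree's `Skeleton.eval1617Rel_of_parts`. Compare
`Skeleton.eval1617Rel_of_leaves` (same, with the printed (16.16)). [cite: Zhang2022LandauSiegel, §16 (16.17) p.95] -/
theorem eval1617Rel_of_R2 (c' : ℝ) (h141 : Prop141) (h010 : Typed.Section16A.Step16_u010 c')
    (h1612 : Typed.Section16A.Eq16_12 c')
    (h16R2 : ∃ C : ℝ, ForAllLarge fun D _ χ => AssumptionA D χ → ∀ j ∈ ({1, 2} : Finset ℕ),
      ‖Typed.Section16A.calS2 c' χ j -
          (frakA χ : ℂ) * frake j * ((Nat.totient D : ℂ) / (D : ℂ)) * deriv χ.LFunction 1‖ ≤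
        C * ((ell D)⁻¹ + (1 + ‖deriv χ.LFunction 1‖) ^ 3 * (ell D ^ 4)⁻¹)) :
    Eval1617Rel c' :=
  eval1617Rel_of_parts c' (fun _ _ χ p => Typed.Section16A.Phi2p c' χ p)
    (eq16_2_of_prop141 c' h141 h010) (step16_u045Rel_of_R2 c' h1612 h16R2)

end Endgame

end Literature.NumberTheory.LFunctions.Zhang2022.Skeleton

end
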